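import Literature.NumberTheory.Automorphic.QuaternionUnitsMultiplicityOneOfTestFamily
import HarnessLib

/-!
# Multiplicity one for `D^×` along a type idempotent: the comparison with a multiplicity-free
# slice of the cusp forms, without a minimal idempotent on the `GL(2)` side
(Gelbart, *Automorphic forms on adele groups* (1975), §10, pp. 151–155 and Thm. 10.10, p. 158;
Jacquet–Langlands, LNM 114 (1970), §16, Lemma 16.1.1 and pp. 496–503)

Topic `NumberTheory/Automorphic`; theorems only (no definition, no named fact, no instance). Part
of the inline (D-0026) decomposition of the named fact
`Literature.NumberTheory.Automorphic.multiplicity_one_quaternionUnits K D` (`JacquetLanglandsParts`,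
Gelbart Thm. 10.10). The assembled forms of that theorem already in the tree
(`not_isOrtho_of_sliceComparison`, `HilbertRepSliceMultiplicityOne`; `not_isOrtho_of_testFamily`
and `multiplicity_one_quaternionUnits_of_testFamily`, `QuaternionUnitsMultiplicityOneOfTestFamily`)
follow Gelbart's text literally: on the `GL(2)` side the idempotent `E₁ = R(ξ_S)` is the
**minimal** idempotent of the local type `σ_S = ⊗_{v ∈ S} π_v(π'_v)` — `ξ_S` is a matrix
coefficient, `E₁ R(k) E₁ = c₁(k) E₁` for **all** `k ∈ G_S` (hypothesis `hE₁K`) — and the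
multiplicity-freeness of Gelbart's `M = R(ξ_S) L²₀` as a representation of the complementary group
`G^S` is *derived* from multiplicity one for `GL(2)` (Thm. 5.7) through that minimality
(`ContRepresentation.eq_of_slice_equivalent`). Matrix coefficients of supercuspidal
representations are compactly supported only modulo the centre, so `R(ξ_S)` is an integrated
operator only on a space with a fixed central character (`R₀^ψ`, Gelbart p. 148); on
`L²(GL₂(K) ℝ_{>0} ∖ GL₂(𝔸_K))`, where all central characters occur and the trace formula of the
tree takes test functions in `C_c(GL₂(𝔸_K))`, the idempotents realised by test functions are those
of **types** — `e = (dim λ) conj ⟨λ(k) w, w⟩` on a compact open subgroup `K_S`, cutting out the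
`(λ, w)`-isotypic vectors (Jacquet–Langlands work with such `K`-finite idempotents `ξ`, pp. 497–503)
— and these are *not* minimal for `G_S`: `e ⋆ δ_k ⋆ e`, `k ∈ G_S ∖ K_S`, acts on the line
`π_S^{(λ,w)}` of each constituent by a scalar depending on the constituent (its central character,
its unramified twist). This file provides the form of Thm. 10.10 adapted to that situation: the
`GL(2)`-side input is directly that **the slice `M = E₁ L²_cusp` is multiplicity-free as a
representation of the complementary group** — for a type idempotent this is strong multiplicity
one for `GL(2)` at the finite set `S` (`strong_multiplicity_one_gl`) together with "a cuspidal
type occurs at most once in an irreducible representation", neither of which is proved here — and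
*no* minimality, no decomposition `Γ₁ = K₁ · G₁`, no multiplicity one or atomicity of `L²_cusp` is
asked on the `GL(2)` side. The quaternion side is unchanged (there the minimal idempotent of the
finite-dimensional local type is available abstractly,
`ClosedSubrep.exists_minimalIdempotent_of_compactModCenter`, and may be chosen below the type
projection, so that its Hilbert–Schmidt sums are dominated by those of `R'(e' ⊗ F)`).

* `not_isOrtho_of_typeComparison` — **operator level** (variant of `not_isOrtho_of_sliceComparison`):
  comparison datum `B` with the Hilbert–Schmidt inequality towards a closed `M ≤ H₁`; on the
  `GL(2)` side a unitary `τ₁` of `Γ₁`, a set `G₁ ⊆ Γ₁` through which the first components of `B`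
  are approximated on `M` (`hApprox₁`), the hypothesis that closed `τ₁(G₁)`-stable subspaces of `M`
  are stable under the first components (`hB₁gen`, true for `B = {(E₁ τ₁(F), …)}`), and
  **multiplicity-freeness of `M` under `τ₁(G₁)`** in submodule form (`hMfree`: closed
  `τ₁(G₁)`-stable, `τ₁(G₁)`-irreducible, non-zero `ρ, ρ' ≤ M` admitting an isometric
  `τ₁(G₁)`-equivariant map of `ρ` onto `ρ'` coincide); the quaternion side as in
  `not_isOrtho_of_sliceComparison`. Conclusion: two irreducible closed `τ₂`-invariant, unitarily
  equivalent `W₁, W₂ ≤ H₂` not killed by the `f₂` are not orthogonal.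
* `not_isOrtho_of_typeTestFamily` — **test-function level** (variant of
  `not_isOrtho_of_testFamily`): `B = {(E₁ τ₁(F₁), E₂ τ₂(F₂)) : (F₁, F₂) ∈ 𝒜}` for a matched
  submodule `𝒜 ≤ C_c(𝔊₁) × C_c(𝔊₂)` closed under convolution and involution with approximate
  identities; `E₁` any self-adjoint idempotent commuting with the commutant of `τ₁(Γ₁)` and with
  `τ₁(ι₁ 𝔊₁)`; `M = {y ∈ L : E₁ y = y}` for a closed invariant `L` (`L²_cusp`), multiplicity-free
  under `τ₁(ι₁ 𝔊₁)`; `hB₁gen` is discharged (integrated operators preserve closed invariant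
  subspaces, `E₁ = 1` on `M`).
* `ContRepresentation.ClosedSubrep.submodule_eq_of_hasMultiplicityOne` — the submodule form of
  multiplicity-freeness from `HasMultiplicityOne` of a closed subrepresentation (bridge to the
  tree's notion, along `restrictLE` / `inflate`).
* `multiplicity_one_quaternionUnits_of_typeTestFamily` — **`multiplicity_one_quaternionUnits K D`
  from, for each pair of equivalent irreducible constituents of `L²(D_𝔸ˣ ⧸ ℝ_{>0} Dˣ)` of dimension
  `≠ 1`: an automorphic measure on the `GL₂` side, a self-adjoint idempotent `E₁` on `L²(GL₂)` in
  the bicommutant commuting with the complementary group (the type projection `R(e_{λ,w})`), the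
  multiplicity-freeness of `M = {y ∈ L²_cusp : E₁ y = y}` under the complementary group, the
  quaternion-side idempotent `E₂` with a non-zero fixed vector in the constituent, the matched test
  functions and the Hilbert–Schmidt inequality `Σ_j ‖E₂ R'(F₂) c_j‖² ≤ Σ_i ‖E₁ R(F₁) b_i‖² < ∞`.**
  Multiplicity one for `GL(2)` no longer appears as a separate hypothesis: it is absorbed in the
  multiplicity-freeness of `M`.

What remains under the named fact after this file, in this form: the complementary groups with
`GL₂(𝔸_K) = G_S · G^S`, `D_𝔸ˣ = G'_S · G'^S`; the type idempotent `e` at `S` with `M_e`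
multiplicity-free under `G^S` (strong multiplicity one for `GL₂` and multiplicity one of cuspidal
types); the quaternion-side datum (in the tree abstractly); matched test functions with approximate
identities; and the trace inequality `‖E₂ R'(F)‖²_HS ≤ ‖R(e ⊗ F F^*)|_{L²_cusp}‖_tr` — the two trace
formulas (10.14), (10.15) for `C_c` test functions and their comparison (10.16)–(10.22). No new
definition, no new named fact.

## References

* S. Gelbart, *Automorphic forms on adele groups*, Ann. of Math. Studies 83 (1975), §10: proof of
  Thm. 10.5 (pp. 151–155), (10.10)–(10.13), Thm. 10.10 (p. 158) [Gelbart1975].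
* H. Jacquet, R. P. Langlands, *Automorphic forms on GL(2)*, LNM 114 (1970), §16, Lemma 16.1.1
  and pp. 496–503 [JacquetLanglands1970].
* A. Deitmar, S. Echterhoff, *Principles of harmonic analysis*, 2nd ed. (2014), Lemma 6.2.2,
  Prop. 6.2.1 [DeitmarEchterhoff2014].
* J. Dixmier, *C*-algebras* (1977), §5.4, §13.1 [Dixmier1977].
-/

noncomputable section

open scoped InnerProductSpace NNReal ENNReal ComplexConjugate
open MeasureTheory Filter Topology CompactlySupported

/-! ### Multiplicity-freeness in submodule form -/

namespace ContRepresentation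

section Bridge

variable {𝔊 : Type*} [Group 𝔊] {H : Type*}
  [NormedAddCommGroup H] [InnerProductSpace ℂ H] [CompleteSpace H]
  {π : ContRepresentation ℂ 𝔊 H}

/-- **Multiplicity one of a closed subrepresentation, in submodule form.** If the representation
on the closed invariant subspace `M` has multiplicity one (`HasMultiplicityOne`: unitarily
equivalent irreducible closed invariant subspaces of `M` coincide), then two closed invariant
subspaces `ρ, ρ' ≤ M` of `H`, irreducible in the sense that their only closed invariant subspaces
are `0` and themselves, `ρ ≠ 0`, and admitting an isometric equivariant map of `ρ` onto `ρ'`,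
coincide. (Transport along `ClosedSubrep.restrictLE` / `inflate`, exactly as in
`eq_of_le_cuspidalSubspace_of_areUnitarilyEquivalent`.) [cite: Dixmier1977, §5.4 and §13.1.5] -/
theorem ClosedSubrep.submodule_eq_of_hasMultiplicityOne (Mc : ClosedSubrep π)
    (hMO : Mc.toContRep.HasMultiplicityOne)
    (ρ ρ' : Submodule ℂ H) (hρc : IsClosed (ρ : Set H)) (hρ'c : IsClosed (ρ' : Set H))
    (hρM : ρ ≤ Mc.toSubmodule) (hρ'M : ρ' ≤ Mc.toSubmodule)
    (hρG : ∀ g : 𝔊, ∀ x ∈ ρ, π g x ∈ ρ) (hρ'G : ∀ g : 𝔊, ∀ x ∈ ρ', π g x ∈ ρ')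
    (hirr : ∀ V : Submodule ℂ H, IsClosed (V : Set H) → V ≤ ρ →
      (∀ g : 𝔊, ∀ x ∈ V, π g x ∈ V) → V = ⊥ ∨ V = ρ)
    (hirr' : ∀ V : Submodule ℂ H, IsClosed (V : Set H) → V ≤ ρ' →
      (∀ g : 𝔊, ∀ x ∈ V, π g x ∈ V) → V = ⊥ ∨ V = ρ')
    (hρ0 : ρ ≠ ⊥)
    (hequiv : ∃ U : ρ →L[ℂ] ρ', (∀ x, ‖U x‖ = ‖x‖) ∧ Function.Surjective U ∧
      ∀ (g : 𝔊) (x : ρ), (U ⟨π g x, hρG g x x.2⟩ : H) = π g (U x)) :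
    ρ = ρ' := by
  -- `ρ`, `ρ'` as closed subrepresentations of `π`
  let ρc : ClosedSubrep π :=
    { toSubmodule := ρ
      apply_mem_toSubmodule := fun g v hv => hρG g v hv
      isClosed' := hρc }
  let ρ'c : ClosedSubrep π :=
    { toSubmodule := ρ'
      apply_mem_toSubmodule := fun g v hv => hρ'G g v hv
      isClosed' := hρ'c }
  have hρcM : ρc ≤ Mc := hρM
  have hρ'cM : ρ'c ≤ Mc := hρ'M
  -- irreducibility
  have hirr_of : ∀ (Nc : ClosedSubrep π), Nc.toSubmodule ≠ ⊥ →
      (∀ V : Submodule ℂ H, IsClosed (V : Set H) → V ≤ Nc.toSubmodule →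
        (∀ g : 𝔊, ∀ x ∈ V, π g x ∈ V) → V = ⊥ ∨ V = Nc.toSubmodule) →
      Nc.toContRep.IsTopIrreducible := by
    intro Nc hN0 hNirr
    rw [ClosedSubrep.isTopIrreducible_toContRep_iff]
    refine ⟨fun h0 => hN0 ?_, fun W' hW' => ?_⟩
    · rw [h0, ClosedSubrep.toSubmodule_bot]
    · rcases hNirr W'.toSubmodule W'.isClosed hW' (fun g x hx => W'.apply_mem g hx) with h | h
      · left
        ext v
        rw [ClosedSubrep.mem_bot, ← ClosedSubrep.mem_toSubmodule, h, Submodule.mem_bot]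
      · right
        ext v
        rw [← ClosedSubrep.mem_toSubmodule, h, ClosedSubrep.mem_toSubmodule]
  have hρirr : ρc.toContRep.IsTopIrreducible := hirr_of ρc hρ0 hirr
  obtain ⟨U, hUn, hUs, hUG⟩ := hequiv
  have hρ'0 : ρ' ≠ ⊥ := by
    obtain ⟨y₀, hy₀, hy₀0⟩ := (Submodule.ne_bot_iff ρ).1 hρ0
    refine (Submodule.ne_bot_iff ρ').2 ⟨U ⟨y₀, hy₀⟩, (U ⟨y₀, hy₀⟩).2, fun h0 => hy₀0 ?_⟩
    have h1 : ‖U ⟨y₀, hy₀⟩‖ = 0 := by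
      rw [← Submodule.norm_coe, h0, norm_zero]
    rw [hUn, norm_eq_zero] at h1
    exact congrArg Subtype.val h1
  have hρ'irr : ρ'c.toContRep.IsTopIrreducible := hirr_of ρ'c hρ'0 hirr'
  -- the unitary equivalence `ρc ≃ ρ'c` built from `U`
  let Uᵢ : ρc.toSubmodule →ₗᵢ[ℂ] H :=
    { toLinearMap := ρ'.subtype ∘ₗ (U : ρ →L[ℂ] ρ').toLinearMap
      norm_map' := fun v => by
        change ‖((U v : ρ') : H)‖ = ‖v‖
        rw [Submodule.norm_coe, hUn] }
  have hUᵢ_apply : ∀ v : ρc.toSubmodule, Uᵢ v = ((U v : ρ') : H) := fun v => rfl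
  have hUᵢ : ∀ (g : 𝔊) (v : ρc.toSubmodule), Uᵢ (ρc.toContRep g v) = π g (Uᵢ v) := by
    intro g v
    rw [hUᵢ_apply, hUᵢ_apply]
    exact hUG g v
  set W'' : ClosedSubrep π := ClosedSubrep.ofLinearIsometry Uᵢ hUᵢ with hW''def
  have hW''eq : W'' = ρ'c := by
    ext y
    rw [hW''def, ClosedSubrep.mem_ofLinearIsometry]
    constructor
    · rintro ⟨v, rfl⟩
      rw [hUᵢ_apply]
      exact (U v).2
    · intro hy
      obtain ⟨v, hv⟩ := hUs ⟨y, hy⟩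
      exact ⟨v, by rw [hUᵢ_apply, hv]⟩
  have hequivc : AreUnitarilyEquivalent ρc.toContRep ρ'c.toContRep := by
    have h : AreUnitarilyEquivalent ρc.toContRep W''.toContRep :=
      ⟨ClosedSubrep.equivOfLinearIsometry Uᵢ hUᵢ,
        AddMonoidHomClass.isometry_of_norm _ fun v => by rw [← Uᵢ.norm_map v]; rfl⟩
    rw [hW''eq] at h
    exact h
  -- pass to `Mc.toContRep` along `restrictLE`
  have e1 := ClosedSubrep.areUnitarilyEquivalent_restrictLE Mc hρcM
  have e2 := ClosedSubrep.areUnitarilyEquivalent_restrictLE Mc hρ'cM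
  have h1 : (Mc.restrictLE ρc).toContRep.IsTopIrreducible := by
    obtain ⟨e, -⟩ := e1
    exact (isTopIrreducible_congr e).2 hρirr
  have h2 : (Mc.restrictLE ρ'c).toContRep.IsTopIrreducible := by
    obtain ⟨e, -⟩ := e2
    exact (isTopIrreducible_congr e).2 hρ'irr
  have hEq : Mc.restrictLE ρc = Mc.restrictLE ρ'c :=
    hMO _ _ h1 h2 (e1.trans (hequivc.trans e2.symm))
  have hEq' : ρc = ρ'c := by
    rw [← ClosedSubrep.inflate_restrictLE Mc hρcM, ← ClosedSubrep.inflate_restrictLE Mc hρ'cM, hEq]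
  exact congrArg (fun W : ClosedSubrep π => W.toSubmodule) hEq'

end Bridge

end ContRepresentation

/-! ### Operator level: the comparison with a multiplicity-free `M` -/

namespace Literature.NumberTheory.Automorphic

open ContRepresentation

section TypeComparison

variable {𝔳 : Type*} {G : 𝔳 → Type*} [∀ v, Group (G v)]
  {Γ₁ : Type*} [Group Γ₁] {Γ₂ : Type*} [Group Γ₂]
  {H₁ : Type*} [NormedAddCommGroup H₁] [InnerProductSpace ℂ H₁] [CompleteSpace H₁]
  {H₂ : Type*} [NormedAddCommGroup H₂] [InnerProductSpace ℂ H₂] [CompleteSpace H₂]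

/-- **Gelbart's Thm. 10.10, abstract form along a type idempotent: no two orthogonal equivalent
constituents on the side with the smaller trace, when the slice `M` on the other side is
multiplicity-free for the complementary group.** Data and hypotheses:

* *comparison* — groups `G v` acting unitarily on `H₁` and `H₂`, a `*`-closed, product-closed,
  translation-stable `ℂ`-linear family `B` of operator pairs (the `(R(e ⊗ F)|…, E₂ R'(F))`), a
  closed subspace `M ≤ H₁` stable under the groups and the `f₁`, and the Hilbert–Schmidt
  inequality `Σ_j ‖f₂ c_j‖² ≤ Σ_i ‖f₁ b_i‖² < ∞` over Hilbert bases of `H₂` and `M`;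
* *`GL(2)` side* — a representation `τ₁` of `Γ₁` on `H₁` and a subset `G₁ ⊆ Γ₁` (the
  complementary group `G^S`) such that the `π₁ v g` are operators `τ₁(g)`, `g ∈ G₁` (`hfam₁`),
  every closed `τ₁(G₁)`-stable subspace of `M` is stable under the `f₁` (`hB₁gen`), on pairs of
  vectors of `M` every `τ₁(g)`, `g ∈ G₁`, is approximated by the `f₁` (`hApprox₁`), and **`M` is
  multiplicity-free under `τ₁(G₁)`** (`hMfree`);
* *quaternion side* — as in `not_isOrtho_of_sliceComparison`: a unitary `τ₂` of `Γ₂ = K₂ · G₂`,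
  an idempotent `E₂` commuting with the commutant of `τ₂(Γ₂)` and with `τ₂(G₂)`, with
  `E₂ τ₂(k) y = c₂(k) y` on `E₂`-fixed vectors (`k ∈ K₂`), the `f₂` commuting with the commutant,
  `E₂ f₂ = f₂ = f₂ E₂`, and approximation of `τ₂(g)`, `g ∈ G₂`, by the `f₂` on `E₂`-fixed vectors.

Conclusion: two topologically irreducible closed `τ₂`-invariant `W₁, W₂ ≤ H₂` which are
unitarily equivalent and not killed by all `f₂` are **not orthogonal**. Proof: as for
`not_isOrtho_of_sliceComparison` — the `E₂`-slices are closed, invariant, irreducible,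
non-degenerate, equivalent and would be orthogonal (`slice_spec_of_isTopIrreducible`,
`slice_equiv_of_equiv`), and the corrected comparison theorem
`not_isOrtho_of_equivalent_of_hilbertSchmidt_le_of_nondegenerate` forbids this once `M` is
multiplicity-free in its sense; the latter now comes from `hMfree`: the subspaces `ρ, ρ'` it
produces are `τ₁(G₁)`-stable and `τ₁(G₁)`-equivariantly isometric by approximation, and
`τ₁(G₁)`-irreducible by `hB₁gen`. [cite: Gelbart1975, Thm. 10.10 (proof), p. 158;
JacquetLanglands1970, §16, Lemma 16.1.1] -/
theorem not_isOrtho_of_typeComparison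
    -- comparison data
    (π₁ : ∀ v, ContRepresentation ℂ (G v) H₁) (π₂ : ∀ v, ContRepresentation ℂ (G v) H₂)
    (hπ₁ : ∀ v, (π₁ v).IsUnitary) (hπ₂ : ∀ v, (π₂ v).IsUnitary)
    (B : Submodule ℂ ((H₁ →L[ℂ] H₁) × (H₂ →L[ℂ] H₂)))
    (hmul : ∀ f ∈ B, ∀ h ∈ B, f * h ∈ B) (hstar : ∀ f ∈ B, star f ∈ B)
    (hG : ∀ (v : 𝔳) (g : G v), ∀ f ∈ B,
      ((π₁ v g, π₂ v g) : (H₁ →L[ℂ] H₁) × (H₂ →L[ℂ] H₂)) * f ∈ B)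
    (M : Submodule ℂ H₁) (hMc : IsClosed (M : Set H₁))
    (hMG : ∀ (v : 𝔳) (g : G v), ∀ x ∈ M, π₁ v g x ∈ M) (hMB : ∀ f ∈ B, ∀ x ∈ M, f.1 x ∈ M)
    {ι : Type*} (b : HilbertBasis ι ℂ M) {κ : Type*} (c : HilbertBasis κ ℂ H₂)
    (hHS : ∀ f ∈ B, ∑' j, (‖f.2 (c j)‖₊ : ℝ≥0∞) ^ 2 ≤ ∑' i, (‖f.1 (b i)‖₊ : ℝ≥0∞) ^ 2)
    (hfin : ∀ f ∈ B, ∑' i, (‖f.1 (b i)‖₊ : ℝ≥0∞) ^ 2 < ∞)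
    -- the `GL(2)` side
    (τ₁ : ContRepresentation ℂ Γ₁ H₁) (Gset₁ : Set Γ₁)
    (hfam₁ : ∀ (v : 𝔳) (g : G v), ∃ γ ∈ Gset₁, π₁ v g = τ₁ γ)
    (hB₁gen : ∀ V : Submodule ℂ H₁, IsClosed (V : Set H₁) → V ≤ M →
      (∀ γ ∈ Gset₁, ∀ x ∈ V, τ₁ γ x ∈ V) → ∀ f ∈ B, ∀ x ∈ V, f.1 x ∈ V)
    (hMfree : ∀ ρ ρ' : Submodule ℂ H₁, IsClosed (ρ : Set H₁) → IsClosed (ρ' : Set H₁) →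
      ρ ≤ M → ρ' ≤ M →
      ∀ (hρG : ∀ γ ∈ Gset₁, ∀ x ∈ ρ, τ₁ γ x ∈ ρ) (_hρ'G : ∀ γ ∈ Gset₁, ∀ x ∈ ρ', τ₁ γ x ∈ ρ'),
      (∀ V : Submodule ℂ H₁, IsClosed (V : Set H₁) → V ≤ ρ →
        (∀ γ ∈ Gset₁, ∀ x ∈ V, τ₁ γ x ∈ V) → V = ⊥ ∨ V = ρ) →
      (∀ V : Submodule ℂ H₁, IsClosed (V : Set H₁) → V ≤ ρ' →
        (∀ γ ∈ Gset₁, ∀ x ∈ V, τ₁ γ x ∈ V) → V = ⊥ ∨ V = ρ') →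
      ρ ≠ ⊥ →
      (∃ U : ρ →L[ℂ] ρ', (∀ x, ‖U x‖ = ‖x‖) ∧ Function.Surjective U ∧
        ∀ γ (hγ : γ ∈ Gset₁) (x : ρ), (U ⟨τ₁ γ x, hρG γ hγ x x.2⟩ : H₁) = τ₁ γ (U x)) →
      ρ = ρ')
    (hApprox₁ : ∀ γ ∈ Gset₁, ∀ y ∈ M, ∀ y' ∈ M, ∀ ε > (0 : ℝ), ∃ f ∈ B,
      ‖f.1 y - τ₁ γ y‖ < ε ∧ ‖f.1 y' - τ₁ γ y'‖ < ε)
    -- the quaternion side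
    (τ₂ : ContRepresentation ℂ Γ₂ H₂) (hτ₂ : τ₂.IsUnitary)
    (Kset₂ Gset₂ : Set Γ₂) (hgen₂ : ∀ γ : Γ₂, ∃ k ∈ Kset₂, ∃ g ∈ Gset₂, γ = k * g)
    (hfam₂ : ∀ (v : 𝔳) (g : G v), ∃ γ ∈ Gset₂, π₂ v g = τ₂ γ)
    (E₂ : H₂ →L[ℂ] H₂) (hE₂idem : ∀ y, E₂ (E₂ y) = E₂ y)
    (hE₂T : ∀ U : H₂ →L[ℂ] H₂, (∀ γ : Γ₂, U ∘L τ₂ γ = τ₂ γ ∘L U) → U ∘L E₂ = E₂ ∘L U)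
    (hE₂G : ∀ γ ∈ Gset₂, ∀ y, E₂ (τ₂ γ y) = τ₂ γ (E₂ y)) (c₂ : Γ₂ → ℂ)
    (hE₂K : ∀ k ∈ Kset₂, ∀ y, E₂ y = y → E₂ (τ₂ k y) = c₂ k • y)
    (hB₂T : ∀ f ∈ B, ∀ U : H₂ →L[ℂ] H₂, (∀ γ : Γ₂, U ∘L τ₂ γ = τ₂ γ ∘L U) →
      U ∘L f.2 = f.2 ∘L U)
    (hB₂E : ∀ f ∈ B, ∀ y, E₂ (f.2 y) = f.2 y) (hB₂E' : ∀ f ∈ B, ∀ y, f.2 (E₂ y) = f.2 y)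
    (hApprox₂ : ∀ γ ∈ Gset₂, ∀ y : H₂, E₂ y = y → ∀ ε > (0 : ℝ), ∃ f ∈ B, ‖f.2 y - τ₂ γ y‖ < ε)
    -- the two constituents
    (W₁ W₂ : ClosedSubrep τ₂) (hW₁ : W₁.toContRep.IsTopIrreducible)
    (hW₂ : W₂.toContRep.IsTopIrreducible)
    (hW : AreUnitarilyEquivalent W₁.toContRep W₂.toContRep)
    (hnd : ∃ f ∈ B, ∃ x ∈ W₁, f.2 x ≠ 0) :
    ¬ W₁.toSubmodule ⟂ W₂.toSubmodule := by
  intro horth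
  obtain ⟨e, he⟩ := hW
  -- the slices
  let mkSlice : ClosedSubrep τ₂ → Submodule ℂ H₂ := fun W =>
    { carrier := {x | x ∈ W ∧ E₂ x = x}
      add_mem' := fun {a b} ha hb =>
        ⟨W.toSubmodule.add_mem ha.1 hb.1, by rw [map_add, ha.2, hb.2]⟩
      zero_mem' := ⟨W.toSubmodule.zero_mem, map_zero E₂⟩
      smul_mem' := fun a y hy => ⟨W.toSubmodule.smul_mem a hy.1, by rw [map_smul, hy.2]⟩ }
  have hσ : ∀ x, x ∈ mkSlice W₁ ↔ x ∈ W₁ ∧ E₂ x = x := fun x => Iff.rfl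
  have hσ' : ∀ x, x ∈ mkSlice W₂ ↔ x ∈ W₂ ∧ E₂ x = x := fun x => Iff.rfl
  obtain ⟨hσc, hσG, hσB, hσirr, hσnd⟩ := slice_spec_of_isTopIrreducible π₂ B τ₂ hτ₂ Kset₂ Gset₂
    hgen₂ hfam₂ E₂ hE₂idem hE₂T hE₂G c₂ hE₂K hB₂T hB₂E hB₂E' hApprox₂ W₁ hW₁ (mkSlice W₁) hσ
  obtain ⟨hσ'c, hσ'G, hσ'B, hσ'irr, -⟩ := slice_spec_of_isTopIrreducible π₂ B τ₂ hτ₂ Kset₂ Gset₂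
    hgen₂ hfam₂ E₂ hE₂idem hE₂T hE₂G c₂ hE₂K hB₂T hB₂E hB₂E' hApprox₂ W₂ hW₂ (mkSlice W₂) hσ'
  obtain ⟨hequiv, hndtr⟩ := slice_equiv_of_equiv π₂ B τ₂ hτ₂ Gset₂ hfam₂ E₂ hE₂T hB₂T W₁ W₂ e he
    (mkSlice W₁) (mkSlice W₂) hσ hσ' hσG hσB
  have hσnd' := hσnd hnd
  have hσ'nd := hndtr hσnd'
  -- the `GL(2)` side is multiplicity-free in the sense of the comparison theorem
  have hM' : ∀ (ρ ρ' : Submodule ℂ H₁), IsClosed (ρ : Set H₁) → IsClosed (ρ' : Set H₁) →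
      ρ ≤ M → ρ' ≤ M →
      ∀ (hρG : ∀ (v : 𝔳) (g : G v), ∀ x ∈ ρ, π₁ v g x ∈ ρ) (hρB : ∀ f ∈ B, ∀ x ∈ ρ, f.1 x ∈ ρ)
        (_hρ'G : ∀ (v : 𝔳) (g : G v), ∀ x ∈ ρ', π₁ v g x ∈ ρ')
        (_hρ'B : ∀ f ∈ B, ∀ x ∈ ρ', f.1 x ∈ ρ'),
      (∀ W : Submodule ℂ H₁, IsClosed (W : Set H₁) → W ≤ ρ →
        (∀ (v : 𝔳) (g : G v), ∀ x ∈ W, π₁ v g x ∈ W) → (∀ f ∈ B, ∀ x ∈ W, f.1 x ∈ W) →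
        W = ⊥ ∨ W = ρ) →
      (∀ W : Submodule ℂ H₁, IsClosed (W : Set H₁) → W ≤ ρ' →
        (∀ (v : 𝔳) (g : G v), ∀ x ∈ W, π₁ v g x ∈ W) → (∀ f ∈ B, ∀ x ∈ W, f.1 x ∈ W) →
        W = ⊥ ∨ W = ρ') →
      (∃ f ∈ B, ∃ x ∈ ρ, f.1 x ≠ 0) → (∃ f ∈ B, ∃ x ∈ ρ', f.1 x ≠ 0) →
      (∃ U : ρ →L[ℂ] ρ', (∀ x, ‖U x‖ = ‖x‖) ∧ Function.Surjective U ∧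
        (∀ (v : 𝔳) (g : G v) (x : ρ), (U ⟨π₁ v g x, hρG v g x x.2⟩ : H₁) = π₁ v g (U x)) ∧
        ∀ f (hf : f ∈ B) (x : ρ), (U ⟨f.1 x, hρB f hf x x.2⟩ : H₁) = f.1 (U x)) →
      ¬ ρ ⟂ ρ' := by
    intro ρ ρ' hρc hρ'c hρM hρ'M hρG hρB hρ'G hρ'B hρirr hρ'irr hρnd _ hUU
    -- `G₁`-invariance of closed `B`-stable subspaces of `M`, by approximation
    have hGinv : ∀ (V : Submodule ℂ H₁), IsClosed (V : Set H₁) → V ≤ M →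
        (∀ f ∈ B, ∀ x ∈ V, f.1 x ∈ V) → ∀ γ ∈ Gset₁, ∀ y ∈ V, τ₁ γ y ∈ V := by
      intro V hVc hVM hVB γ hγ y hy
      refine Submodule.mem_of_forall_exists_norm_sub_lt hVc fun ε hε => ?_
      obtain ⟨f, hf, h1, -⟩ := hApprox₁ γ hγ y (hVM hy) y (hVM hy) ε hε
      exact ⟨f.1 y, hVB f hf y hy, h1⟩
    have hρG₁ := hGinv ρ hρc hρM hρB
    have hρ'G₁ := hGinv ρ' hρ'c hρ'M hρ'B
    -- irreducibility under `τ₁(G₁)` alone, by `hB₁gen`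
    have hirr_conv : ∀ (ρ₀ : Submodule ℂ H₁), ρ₀ ≤ M →
        (∀ W : Submodule ℂ H₁, IsClosed (W : Set H₁) → W ≤ ρ₀ →
          (∀ (v : 𝔳) (g : G v), ∀ x ∈ W, π₁ v g x ∈ W) → (∀ f ∈ B, ∀ x ∈ W, f.1 x ∈ W) →
          W = ⊥ ∨ W = ρ₀) →
        ∀ V : Submodule ℂ H₁, IsClosed (V : Set H₁) → V ≤ ρ₀ →
          (∀ γ ∈ Gset₁, ∀ x ∈ V, τ₁ γ x ∈ V) → V = ⊥ ∨ V = ρ₀ := by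
      intro ρ₀ hρ₀M hρ₀irr V hVc hVρ hVG
      refine hρ₀irr V hVc hVρ (fun v g x hx => ?_) (hB₁gen V hVc (hVρ.trans hρ₀M) hVG)
      obtain ⟨γ, hγ, hπγ⟩ := hfam₁ v g
      rw [hπγ]
      exact hVG γ hγ x hx
    have hρ0 : ρ ≠ ⊥ := by
      obtain ⟨f, hf, x, hx, hfx⟩ := hρnd
      intro h0
      rw [h0, Submodule.mem_bot] at hx
      exact hfx (by rw [hx, map_zero])
    -- the equivalence commutes with `τ₁(G₁)`, by approximation
    obtain ⟨U, hUn, hUs, -, hUB⟩ := hUU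
    have hUG₁ : ∀ γ (hγ : γ ∈ Gset₁) (y : ρ),
        (U ⟨τ₁ γ y, hρG₁ γ hγ y y.2⟩ : H₁) = τ₁ γ (U y) := by
      intro γ hγ y
      have key : ∀ ε > (0 : ℝ), ‖(U ⟨τ₁ γ y, hρG₁ γ hγ y y.2⟩ : H₁) - τ₁ γ (U y)‖ < ε := by
        intro ε hε
        obtain ⟨f, hf, h1, h2⟩ :=
          hApprox₁ γ hγ y (hρM y.2) (U y) (hρ'M (U y).2) (ε / 2) (half_pos hε)
        have hA : (U ⟨f.1 y, hρB f hf y y.2⟩ : H₁) = f.1 (U y) := hUB f hf y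
        have hdiff : ‖(U ⟨τ₁ γ y, hρG₁ γ hγ y y.2⟩ : H₁) - (U ⟨f.1 y, hρB f hf y y.2⟩ : H₁)‖ =
            ‖f.1 y - τ₁ γ y‖ := by
          rw [← Submodule.coe_sub, Submodule.norm_coe, ← map_sub, hUn, ← Submodule.norm_coe,
            Submodule.coe_sub, norm_sub_rev]
        calc ‖(U ⟨τ₁ γ y, hρG₁ γ hγ y y.2⟩ : H₁) - τ₁ γ (U y)‖
            = ‖((U ⟨τ₁ γ y, hρG₁ γ hγ y y.2⟩ : H₁) - (U ⟨f.1 y, hρB f hf y y.2⟩ : H₁)) +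
                (f.1 (U y) - τ₁ γ (U y))‖ := by rw [hA, sub_add_sub_cancel]
          _ ≤ ‖(U ⟨τ₁ γ y, hρG₁ γ hγ y y.2⟩ : H₁) - (U ⟨f.1 y, hρB f hf y y.2⟩ : H₁)‖ +
                ‖f.1 (U y) - τ₁ γ (U y)‖ := norm_add_le _ _
          _ < ε / 2 + ε / 2 := by rw [hdiff]; exact add_lt_add h1 h2
          _ = ε := add_halves ε
      by_contra hne
      have hpos : 0 < ‖(U ⟨τ₁ γ y, hρG₁ γ hγ y y.2⟩ : H₁) - τ₁ γ (U y)‖ :=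
        norm_pos_iff.2 (sub_ne_zero.2 hne)
      exact lt_irrefl _ (key _ hpos)
    have hEq : ρ = ρ' :=
      hMfree ρ ρ' hρc hρ'c hρM hρ'M hρG₁ hρ'G₁ (hirr_conv ρ hρM hρirr) (hirr_conv ρ' hρ'M hρ'irr)
        hρ0 ⟨U, hUn, hUs, hUG₁⟩
    rw [← hEq, Submodule.isOrtho_self]
    exact hρ0
  -- the slices would be orthogonal
  have hle₁ : mkSlice W₁ ≤ W₁.toSubmodule := fun x hx => hx.1
  have hle₂ : mkSlice W₂ ≤ W₂.toSubmodule := fun x hx => hx.1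
  exact not_isOrtho_of_equivalent_of_hilbertSchmidt_le_of_nondegenerate π₁ π₂ hπ₁ hπ₂ B hmul hstar
    hG M hMc hMG hMB b c hHS hfin hM' (mkSlice W₁) (mkSlice W₂) hσc hσ'c hσG hσB hσ'G hσ'B hσirr
    hσ'irr hσnd' hσ'nd hequiv (horth.mono hle₁ hle₂)

end TypeComparison

/-! ### Test-function level -/

section TypeTestFamily

variable {Γ₁ Γ₂ : Type*} [Group Γ₁] [Group Γ₂]
  {H₁ : Type*} [NormedAddCommGroup H₁] [InnerProductSpace ℂ H₁] [CompleteSpace H₁]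
  {H₂ : Type*} [NormedAddCommGroup H₂] [InnerProductSpace ℂ H₂] [CompleteSpace H₂]
  {𝔊₁ : Type*} [Group 𝔊₁] [TopologicalSpace 𝔊₁] [IsTopologicalGroup 𝔊₁] [MeasurableSpace 𝔊₁]
  [BorelSpace 𝔊₁] [SecondCountableTopology 𝔊₁]
  {𝔊₂ : Type*} [Group 𝔊₂] [TopologicalSpace 𝔊₂] [IsTopologicalGroup 𝔊₂] [MeasurableSpace 𝔊₂]
  [BorelSpace 𝔊₂] [SecondCountableTopology 𝔊₂]

/-- **Gelbart's Thm. 10.10 from a matched family of test functions, along a type idempotent.**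
Setting as in `not_isOrtho_of_testFamily` — unitary `τ₁` of `Γ₁` on `H₁` (the `GL(2)` side) and
`τ₂` of `Γ₂` on `H₂` (the quaternion side), locally compact second countable groups `𝔊₁`, `𝔊₂`
with left- and inversion-invariant measures finite on compacts and homomorphisms `ιᵢ : 𝔊ᵢ → Γᵢ`
along which `τᵢ` is strongly continuous, a matched submodule `𝒜` of test-function pairs closed
under convolution and involution with approximate identities, and the Hilbert–Schmidt inequality
`Σ_j ‖E₂ τ₂(F₂) c_j‖² ≤ Σ_i ‖E₁ τ₁(F₁) b_i‖² < ∞` over Hilbert bases of `H₂` and `M` — except on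
the `GL(2)` side, where now: `E₁` is **any** self-adjoint idempotent commuting with the commutant
of `τ₁(Γ₁)` and with `τ₁(ι₁ 𝔊₁)` (a type projection `R(e)`), `M = {y ∈ L : E₁ y = y}` for a closed
`τ₁`-invariant `L` (`L²_cusp`), and **`M` is multiplicity-free under `τ₁(ι₁ 𝔊₁)`** (`hMfree`:
closed `𝔊₁`-stable `𝔊₁`-irreducible non-zero `ρ, ρ' ≤ M` related by an isometric
`𝔊₁`-equivariant map of `ρ` onto `ρ'` coincide) — no decomposition `Γ₁ = K₁ · ι₁(𝔊₁)`, no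
minimality of `E₁`, no multiplicity one or atomicity of `L`. The quaternion side is that of
`not_isOrtho_of_testFamily`. Conclusion: two irreducible closed `τ₂`-invariant `W₁ ≅ W₂ ≤ H₂` with
a non-zero `E₂`-fixed vector in `W₁` are **not orthogonal**. Proof: `not_isOrtho_of_typeComparison`
for `B = {(E₁ τ₁(F₁), E₂ τ₂(F₂))}`; its hypothesis `hB₁gen` holds because an integrated operator
`τ₁(F₁)` preserves every closed `τ₁(ι₁ 𝔊₁)`-stable subspace (`integratedOperator_apply_mem`) and
`E₁ = 1` on `M`. [cite: Gelbart1975, Thm. 10.10 (proof), p. 158, and proof of Thm. 10.5,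
pp. 151–155; JacquetLanglands1970, §16, Lemma 16.1.1 and pp. 496–503] -/
theorem not_isOrtho_of_typeTestFamily
    (η₁ : Measure 𝔊₁) [IsFiniteMeasureOnCompacts η₁] [SFinite η₁] [η₁.IsMulLeftInvariant]
    [η₁.IsInvInvariant]
    (η₂ : Measure 𝔊₂) [IsFiniteMeasureOnCompacts η₂] [SFinite η₂] [η₂.IsMulLeftInvariant]
    [η₂.IsInvInvariant]
    -- the `GL(2)` side
    (τ₁ : ContRepresentation ℂ Γ₁ H₁) (hτ₁ : τ₁.IsUnitary) (ι₁ : 𝔊₁ →* Γ₁)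
    (hc₁ : (τ₁.restrict ι₁).IsStronglyContinuous)
    (L : ClosedSubrep τ₁)
    (E₁ : H₁ →L[ℂ] H₁) (hE₁sa : ∀ u v : H₁, ⟪E₁ u, v⟫_ℂ = ⟪u, E₁ v⟫_ℂ)
    (hE₁idem : ∀ v, E₁ (E₁ v) = E₁ v)
    (hE₁T : ∀ U : H₁ →L[ℂ] H₁, (∀ γ : Γ₁, U ∘L τ₁ γ = τ₁ γ ∘L U) → U ∘L E₁ = E₁ ∘L U)
    (hE₁ι : ∀ g : 𝔊₁, E₁ ∘L τ₁ (ι₁ g) = τ₁ (ι₁ g) ∘L E₁)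
    (M : Submodule ℂ H₁) (hM : ∀ y, y ∈ M ↔ y ∈ L ∧ E₁ y = y)
    (hMfree : ∀ ρ ρ' : Submodule ℂ H₁, IsClosed (ρ : Set H₁) → IsClosed (ρ' : Set H₁) →
      ρ ≤ M → ρ' ≤ M →
      ∀ (hρG : ∀ g : 𝔊₁, ∀ x ∈ ρ, τ₁ (ι₁ g) x ∈ ρ) (_hρ'G : ∀ g : 𝔊₁, ∀ x ∈ ρ', τ₁ (ι₁ g) x ∈ ρ'),
      (∀ V : Submodule ℂ H₁, IsClosed (V : Set H₁) → V ≤ ρ →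
        (∀ g : 𝔊₁, ∀ x ∈ V, τ₁ (ι₁ g) x ∈ V) → V = ⊥ ∨ V = ρ) →
      (∀ V : Submodule ℂ H₁, IsClosed (V : Set H₁) → V ≤ ρ' →
        (∀ g : 𝔊₁, ∀ x ∈ V, τ₁ (ι₁ g) x ∈ V) → V = ⊥ ∨ V = ρ') →
      ρ ≠ ⊥ →
      (∃ U : ρ →L[ℂ] ρ', (∀ x, ‖U x‖ = ‖x‖) ∧ Function.Surjective U ∧
        ∀ (g : 𝔊₁) (x : ρ), (U ⟨τ₁ (ι₁ g) x, hρG g x x.2⟩ : H₁) = τ₁ (ι₁ g) (U x)) →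
      ρ = ρ')
    {ι : Type*} (b : HilbertBasis ι ℂ M) {κ : Type*} (c : HilbertBasis κ ℂ H₂)
    -- the quaternion side
    (τ₂ : ContRepresentation ℂ Γ₂ H₂) (hτ₂ : τ₂.IsUnitary) (ι₂ : 𝔊₂ →* Γ₂)
    (hc₂ : (τ₂.restrict ι₂).IsStronglyContinuous)
    (Kset₂ : Set Γ₂) (hgen₂ : ∀ γ : Γ₂, ∃ k ∈ Kset₂, ∃ g : 𝔊₂, γ = k * ι₂ g)
    (E₂ : H₂ →L[ℂ] H₂) (hE₂sa : ∀ u v : H₂, ⟪E₂ u, v⟫_ℂ = ⟪u, E₂ v⟫_ℂ)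
    (hE₂idem : ∀ v, E₂ (E₂ v) = E₂ v)
    (hE₂T : ∀ U : H₂ →L[ℂ] H₂, (∀ γ : Γ₂, U ∘L τ₂ γ = τ₂ γ ∘L U) → U ∘L E₂ = E₂ ∘L U)
    (hE₂ι : ∀ g : 𝔊₂, E₂ ∘L τ₂ (ι₂ g) = τ₂ (ι₂ g) ∘L E₂) (c₂ : Γ₂ → ℂ)
    (hE₂K : ∀ k ∈ Kset₂, ∀ y, E₂ y = y → E₂ (τ₂ k y) = c₂ k • y)
    -- the matched family of test functions
    (𝒜 : Submodule ℂ (C_c(𝔊₁, ℂ) × C_c(𝔊₂, ℂ)))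
    (h𝒜conv : ∀ a ∈ 𝒜, ∀ a' ∈ 𝒜, ∃ d ∈ 𝒜, (∀ x, d.1 x = mulConv η₁ (⇑a.1) (⇑a'.1) x) ∧
      (∀ x, d.2 x = mulConv η₂ (⇑a.2) (⇑a'.2) x))
    (h𝒜star : ∀ a ∈ 𝒜, ∃ d ∈ 𝒜, (∀ x, d.1 x = mulStar (⇑a.1) x) ∧ (∀ x, d.2 x = mulStar (⇑a.2) x))
    (h𝒜δ₁ : ∀ (g : 𝔊₁) (U : Set 𝔊₁), U ∈ 𝓝 g → ∃ a ∈ 𝒜, (∀ x, 0 ≤ (a.1 x).re ∧ (a.1 x).im = 0) ∧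
      tsupport a.1 ⊆ U ∧ ∫ x, (a.1 x).re ∂η₁ = 1)
    (h𝒜δ₂ : ∀ (g : 𝔊₂) (U : Set 𝔊₂), U ∈ 𝓝 g → ∃ a ∈ 𝒜, (∀ x, 0 ≤ (a.2 x).re ∧ (a.2 x).im = 0) ∧
      tsupport a.2 ⊆ U ∧ ∫ x, (a.2 x).re ∂η₂ = 1)
    (hHS : ∀ a ∈ 𝒜,
      ∑' j, (‖E₂ ((τ₂.restrict ι₂).integratedOperator (hτ₂.restrict ι₂) hc₂ η₂ a.2 (c j))‖₊ :
          ℝ≥0∞) ^ 2 ≤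
        ∑' i, (‖E₁ ((τ₁.restrict ι₁).integratedOperator (hτ₁.restrict ι₁) hc₁ η₁ a.1 (b i))‖₊ :
          ℝ≥0∞) ^ 2)
    (hfin : ∀ a ∈ 𝒜,
      ∑' i, (‖E₁ ((τ₁.restrict ι₁).integratedOperator (hτ₁.restrict ι₁) hc₁ η₁ a.1 (b i))‖₊ :
        ℝ≥0∞) ^ 2 < ∞)
    -- the two constituents
    (W₁ W₂ : ClosedSubrep τ₂) (hW₁ : W₁.toContRep.IsTopIrreducible)
    (hW₂ : W₂.toContRep.IsTopIrreducible) (hW : AreUnitarilyEquivalent W₁.toContRep W₂.toContRep)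
    (hx : ∃ x ∈ W₁, x ≠ 0 ∧ E₂ x = x) :
    ¬ W₁.toSubmodule ⟂ W₂.toSubmodule := by
  -- the integrated operators of the complementary groups
  set R₁ : C_c(𝔊₁, ℂ) → (H₁ →L[ℂ] H₁) := fun F =>
    (τ₁.restrict ι₁).integratedOperator (hτ₁.restrict ι₁) hc₁ η₁ F with hR₁
  set R₂ : C_c(𝔊₂, ℂ) → (H₂ →L[ℂ] H₂) := fun F =>
    (τ₂.restrict ι₂).integratedOperator (hτ₂.restrict ι₂) hc₂ η₂ F with hR₂
  -- `Eᵢ` commutes with the `Rᵢ F`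
  have hER₁ : ∀ F, E₁ ∘L R₁ F = R₁ F ∘L E₁ := fun F =>
    comp_integratedOperator_eq_integratedOperator_comp _ _ _ η₁ F E₁ fun g => hE₁ι g
  have hER₂ : ∀ F, E₂ ∘L R₂ F = R₂ F ∘L E₂ := fun F =>
    comp_integratedOperator_eq_integratedOperator_comp _ _ _ η₂ F E₂ fun g => hE₂ι g
  have hE₁E₁ : E₁ ∘L E₁ = E₁ := ContinuousLinearMap.ext fun v => hE₁idem v
  have hE₂E₂ : E₂ ∘L E₂ = E₂ := ContinuousLinearMap.ext fun v => hE₂idem v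
  have hE₁adj : ContinuousLinearMap.adjoint E₁ = E₁ :=
    ((ContinuousLinearMap.eq_adjoint_iff _ _).mpr fun x y => hE₁sa x y).symm
  have hE₂adj : ContinuousLinearMap.adjoint E₂ = E₂ :=
    ((ContinuousLinearMap.eq_adjoint_iff _ _).mpr fun x y => hE₂sa x y).symm
  -- the linear map `(F₁, F₂) ↦ (E₁ τ₁(F₁), E₂ τ₂(F₂))` and the family `B`
  let Ψ : (C_c(𝔊₁, ℂ) × C_c(𝔊₂, ℂ)) →ₗ[ℂ] ((H₁ →L[ℂ] H₁) × (H₂ →L[ℂ] H₂)) :=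
    { toFun := fun a => (E₁ ∘L R₁ a.1, E₂ ∘L R₂ a.2)
      map_add' := fun a a' => by
        ext1
        · change E₁ ∘L R₁ (a.1 + a'.1) = E₁ ∘L R₁ a.1 + E₁ ∘L R₁ a'.1
          rw [hR₁]
          dsimp only
          rw [integratedOperator_add, ContinuousLinearMap.comp_add]
        · change E₂ ∘L R₂ (a.2 + a'.2) = E₂ ∘L R₂ a.2 + E₂ ∘L R₂ a'.2
          rw [hR₂]
          dsimp only
          rw [integratedOperator_add, ContinuousLinearMap.comp_add]
      map_smul' := fun z a => by
        ext1
        · change E₁ ∘L R₁ (z • a.1) = z • (E₁ ∘L R₁ a.1)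
          rw [hR₁]
          dsimp only
          rw [integratedOperator_smul, ContinuousLinearMap.comp_smul]
        · change E₂ ∘L R₂ (z • a.2) = z • (E₂ ∘L R₂ a.2)
          rw [hR₂]
          dsimp only
          rw [integratedOperator_smul, ContinuousLinearMap.comp_smul] }
  have hΨ : ∀ a, Ψ a = (E₁ ∘L R₁ a.1, E₂ ∘L R₂ a.2) := fun a => rfl
  set B : Submodule ℂ ((H₁ →L[ℂ] H₁) × (H₂ →L[ℂ] H₂)) := 𝒜.map Ψ with hBdef
  have hmemB : ∀ {f}, f ∈ B ↔ ∃ a ∈ 𝒜, Ψ a = f := fun {f} => Submodule.mem_map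
  -- closure under products
  have hmul : ∀ f ∈ B, ∀ h ∈ B, f * h ∈ B := by
    intro f hf h hh
    obtain ⟨a, ha, rfl⟩ := hmemB.1 hf
    obtain ⟨a', ha', rfl⟩ := hmemB.1 hh
    obtain ⟨d, hd, hd1, hd2⟩ := h𝒜conv a ha a' ha'
    refine hmemB.2 ⟨d, hd, ?_⟩
    rw [hΨ, hΨ, hΨ, Prod.mk_mul_mk]
    ext1
    · change E₁ ∘L R₁ d.1 = (E₁ ∘L R₁ a.1) ∘L (E₁ ∘L R₁ a'.1)
      rw [ContinuousLinearMap.comp_assoc, ← ContinuousLinearMap.comp_assoc (R₁ a.1), ← hER₁,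
        ContinuousLinearMap.comp_assoc, ← ContinuousLinearMap.comp_assoc E₁ E₁, hE₁E₁]
      congr 1
      exact (integratedOperator_comp_integratedOperator _ _ η₁ a.1 a'.1 d.1 hd1).symm
    · change E₂ ∘L R₂ d.2 = (E₂ ∘L R₂ a.2) ∘L (E₂ ∘L R₂ a'.2)
      rw [ContinuousLinearMap.comp_assoc, ← ContinuousLinearMap.comp_assoc (R₂ a.2), ← hER₂,
        ContinuousLinearMap.comp_assoc, ← ContinuousLinearMap.comp_assoc E₂ E₂, hE₂E₂]
      congr 1
      exact (integratedOperator_comp_integratedOperator _ _ η₂ a.2 a'.2 d.2 hd2).symm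
  -- closure under adjoints
  have hstar : ∀ f ∈ B, star f ∈ B := by
    intro f hf
    obtain ⟨a, ha, rfl⟩ := hmemB.1 hf
    obtain ⟨d, hd, hd1, hd2⟩ := h𝒜star a ha
    refine hmemB.2 ⟨d, hd, ?_⟩
    rw [hΨ, hΨ]
    ext1
    · change E₁ ∘L R₁ d.1 = star (E₁ ∘L R₁ a.1)
      rw [ContinuousLinearMap.star_eq_adjoint, ContinuousLinearMap.adjoint_comp, hE₁adj,
        adjoint_integratedOperator _ _ η₁ a.1 d.1 hd1, ← hER₁]
    · change E₂ ∘L R₂ d.2 = star (E₂ ∘L R₂ a.2)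
      rw [ContinuousLinearMap.star_eq_adjoint, ContinuousLinearMap.adjoint_comp, hE₂adj,
        adjoint_integratedOperator _ _ η₂ a.2 d.2 hd2, ← hER₂]
  -- `M` is closed and stable under the first components
  have hMc : IsClosed (M : Set H₁) := by
    have : (M : Set H₁) = (L : Set H₁) ∩ {y | E₁ y = y} := Set.ext fun y => hM y
    rw [this]
    exact L.isClosed.inter (isClosed_eq E₁.continuous continuous_id)
  have hML : M ≤ L.toSubmodule := fun y hy => ((hM y).1 hy).1
  have hME : ∀ y ∈ M, E₁ y = y := fun y hy => ((hM y).1 hy).2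
  -- integrated operators preserve closed `τ₁(ι₁ 𝔊₁)`-stable subspaces
  have hR₁inv : ∀ (V : Submodule ℂ H₁), IsClosed (V : Set H₁) →
      (∀ g : 𝔊₁, ∀ x ∈ V, τ₁ (ι₁ g) x ∈ V) → ∀ F, ∀ y ∈ V, R₁ F y ∈ V := by
    intro V hVc hVG F y hy
    let V' : ClosedSubrep (τ₁.restrict ι₁) :=
      { toSubmodule := V
        apply_mem_toSubmodule := fun g v hv => hVG g v hv
        isClosed' := hVc }
    exact integratedOperator_apply_mem (hτ₁.restrict ι₁) hc₁ η₁ F V' hy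
  have hR₁L : ∀ F, ∀ y ∈ L, R₁ F y ∈ L := fun F y hy =>
    hR₁inv L.toSubmodule L.isClosed (fun g x hx => L.apply_mem (ι₁ g) hx) F y hy
  have hMB : ∀ f ∈ B, ∀ x ∈ M, f.1 x ∈ M := by
    intro f hf x hx
    obtain ⟨a, ha, rfl⟩ := hmemB.1 hf
    rw [hΨ]
    change E₁ (R₁ a.1 x) ∈ M
    exact (hM _).2 ⟨ClosedSubrep.apply_mem_of_forall_comp_eq hτ₁ hE₁T L (hR₁L a.1 x (hML hx)),
      hE₁idem _⟩
  -- closed `τ₁(ι₁ 𝔊₁)`-stable subspaces of `M` are stable under the first components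
  have hB₁gen : ∀ V : Submodule ℂ H₁, IsClosed (V : Set H₁) → V ≤ M →
      (∀ γ ∈ Set.range ι₁, ∀ x ∈ V, τ₁ γ x ∈ V) → ∀ f ∈ B, ∀ x ∈ V, f.1 x ∈ V := by
    intro V hVc hVM hVG f hf x hx
    obtain ⟨a, ha, rfl⟩ := hmemB.1 hf
    rw [hΨ]
    change E₁ (R₁ a.1 x) ∈ V
    have h1 : R₁ a.1 x ∈ V := hR₁inv V hVc (fun g y hy => hVG (ι₁ g) ⟨g, rfl⟩ y hy) a.1 x hx
    rwa [hME _ (hVM h1)]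
  -- first and second components commute with the commutants
  have hB₁T : ∀ f ∈ B, ∀ U : H₁ →L[ℂ] H₁, (∀ γ : Γ₁, U ∘L τ₁ γ = τ₁ γ ∘L U) →
      U ∘L f.1 = f.1 ∘L U := by
    intro f hf U hU
    obtain ⟨a, ha, rfl⟩ := hmemB.1 hf
    rw [hΨ]
    change U ∘L (E₁ ∘L R₁ a.1) = (E₁ ∘L R₁ a.1) ∘L U
    rw [← ContinuousLinearMap.comp_assoc, hE₁T U hU, ContinuousLinearMap.comp_assoc,
      comp_integratedOperator_eq_integratedOperator_comp _ _ _ η₁ a.1 U (fun g => hU (ι₁ g)),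
      ContinuousLinearMap.comp_assoc]
  have hB₂T : ∀ f ∈ B, ∀ U : H₂ →L[ℂ] H₂, (∀ γ : Γ₂, U ∘L τ₂ γ = τ₂ γ ∘L U) →
      U ∘L f.2 = f.2 ∘L U := by
    intro f hf U hU
    obtain ⟨a, ha, rfl⟩ := hmemB.1 hf
    rw [hΨ]
    change U ∘L (E₂ ∘L R₂ a.2) = (E₂ ∘L R₂ a.2) ∘L U
    rw [← ContinuousLinearMap.comp_assoc, hE₂T U hU, ContinuousLinearMap.comp_assoc,
      comp_integratedOperator_eq_integratedOperator_comp _ _ _ η₂ a.2 U (fun g => hU (ι₂ g)),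
      ContinuousLinearMap.comp_assoc]
  have hB₂E : ∀ f ∈ B, ∀ y, E₂ (f.2 y) = f.2 y := by
    intro f hf y
    obtain ⟨a, ha, rfl⟩ := hmemB.1 hf
    exact hE₂idem _
  have hB₂E' : ∀ f ∈ B, ∀ y, f.2 (E₂ y) = f.2 y := by
    intro f hf y
    obtain ⟨a, ha, rfl⟩ := hmemB.1 hf
    rw [hΨ]
    change (E₂ ∘L R₂ a.2) (E₂ y) = (E₂ ∘L R₂ a.2) y
    rw [hER₂, ContinuousLinearMap.comp_apply, ContinuousLinearMap.comp_apply, hE₂idem]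
  -- approximation of `τᵢ(ιᵢ g₀)` by the components of `B`
  have hApprox₁ : ∀ γ ∈ Set.range ι₁, ∀ y ∈ M, ∀ y' ∈ M, ∀ ε > (0 : ℝ), ∃ f ∈ B,
      ‖f.1 y - τ₁ γ y‖ < ε ∧ ‖f.1 y' - τ₁ γ y'‖ < ε := by
    rintro _ ⟨g₀, rfl⟩ y hy y' hy' ε hε
    set U : Set 𝔊₁ := {g | ‖τ₁ (ι₁ g) y - τ₁ (ι₁ g₀) y‖ < ε / 2 ∧
      ‖τ₁ (ι₁ g) y' - τ₁ (ι₁ g₀) y'‖ < ε / 2} with hUdef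
    have hUo : IsOpen U := by
      refine IsOpen.inter ?_ ?_
      · exact isOpen_lt (((hc₁ y).sub continuous_const).norm) continuous_const
      · exact isOpen_lt (((hc₁ y').sub continuous_const).norm) continuous_const
    have hg₀U : g₀ ∈ U := by
      constructor <;> simp [half_pos hε]
    obtain ⟨a, ha, hre, hsupp, h1⟩ := h𝒜δ₁ g₀ U (hUo.mem_nhds hg₀U)
    refine ⟨Ψ a, hmemB.2 ⟨a, ha, rfl⟩, ?_, ?_⟩
    · rw [hΨ]
      change ‖(E₁ ∘L R₁ a.1) y - τ₁ (ι₁ g₀) y‖ < ε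
      rw [hER₁, ContinuousLinearMap.comp_apply, hME y hy]
      refine lt_of_le_of_lt (norm_integratedOperator_apply_sub_le_of_integral_eq_one _ hc₁ η₁ a.1
        hre h1 y g₀ fun g hg => (le_of_lt (hsupp hg).1)) (half_lt_self hε)
    · rw [hΨ]
      change ‖(E₁ ∘L R₁ a.1) y' - τ₁ (ι₁ g₀) y'‖ < ε
      rw [hER₁, ContinuousLinearMap.comp_apply, hME y' hy']
      refine lt_of_le_of_lt (norm_integratedOperator_apply_sub_le_of_integral_eq_one _ hc₁ η₁ a.1
        hre h1 y' g₀ fun g hg => (le_of_lt (hsupp hg).2)) (half_lt_self hε)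
  have hApprox₂ : ∀ γ ∈ Set.range ι₂, ∀ y : H₂, E₂ y = y → ∀ ε > (0 : ℝ), ∃ f ∈ B,
      ‖f.2 y - τ₂ γ y‖ < ε := by
    rintro _ ⟨g₀, rfl⟩ y hy ε hε
    set U : Set 𝔊₂ := {g | ‖τ₂ (ι₂ g) y - τ₂ (ι₂ g₀) y‖ < ε / 2} with hUdef
    have hUo : IsOpen U := isOpen_lt (((hc₂ y).sub continuous_const).norm) continuous_const
    have hg₀U : g₀ ∈ U := by simp [hUdef, half_pos hε]
    obtain ⟨a, ha, hre, hsupp, h1⟩ := h𝒜δ₂ g₀ U (hUo.mem_nhds hg₀U)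
    refine ⟨Ψ a, hmemB.2 ⟨a, ha, rfl⟩, ?_⟩
    rw [hΨ]
    change ‖(E₂ ∘L R₂ a.2) y - τ₂ (ι₂ g₀) y‖ < ε
    rw [hER₂, ContinuousLinearMap.comp_apply, hy]
    exact lt_of_le_of_lt (norm_integratedOperator_apply_sub_le_of_integral_eq_one _ hc₂ η₂ a.2
      hre h1 y g₀ fun g hg => (le_of_lt (hsupp hg))) (half_lt_self hε)
  -- multiplicity-freeness of `M` under `τ₁(range ι₁)`
  have hMfree' : ∀ ρ ρ' : Submodule ℂ H₁, IsClosed (ρ : Set H₁) → IsClosed (ρ' : Set H₁) →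
      ρ ≤ M → ρ' ≤ M →
      ∀ (hρG : ∀ γ ∈ Set.range ι₁, ∀ x ∈ ρ, τ₁ γ x ∈ ρ)
        (_hρ'G : ∀ γ ∈ Set.range ι₁, ∀ x ∈ ρ', τ₁ γ x ∈ ρ'),
      (∀ V : Submodule ℂ H₁, IsClosed (V : Set H₁) → V ≤ ρ →
        (∀ γ ∈ Set.range ι₁, ∀ x ∈ V, τ₁ γ x ∈ V) → V = ⊥ ∨ V = ρ) →
      (∀ V : Submodule ℂ H₁, IsClosed (V : Set H₁) → V ≤ ρ' →
        (∀ γ ∈ Set.range ι₁, ∀ x ∈ V, τ₁ γ x ∈ V) → V = ⊥ ∨ V = ρ') →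
      ρ ≠ ⊥ →
      (∃ U : ρ →L[ℂ] ρ', (∀ x, ‖U x‖ = ‖x‖) ∧ Function.Surjective U ∧
        ∀ γ (hγ : γ ∈ Set.range ι₁) (x : ρ), (U ⟨τ₁ γ x, hρG γ hγ x x.2⟩ : H₁) = τ₁ γ (U x)) →
      ρ = ρ' := by
    intro ρ ρ' hρc hρ'c hρM hρ'M hρG hρ'G hirr hirr' hρ0 hUU
    obtain ⟨U, hUn, hUs, hUG⟩ := hUU
    refine hMfree ρ ρ' hρc hρ'c hρM hρ'M (fun g x hx => hρG (ι₁ g) ⟨g, rfl⟩ x hx)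
      (fun g x hx => hρ'G (ι₁ g) ⟨g, rfl⟩ x hx) (fun V hVc hVρ hVG => hirr V hVc hVρ ?_)
      (fun V hVc hVρ hVG => hirr' V hVc hVρ ?_) hρ0 ⟨U, hUn, hUs, fun g x => hUG (ι₁ g) ⟨g, rfl⟩ x⟩
    · rintro _ ⟨g, rfl⟩ x hx
      exact hVG g x hx
    · rintro _ ⟨g, rfl⟩ x hx
      exact hVG g x hx
  -- the Hilbert–Schmidt inequality along `B`
  have hHS' : ∀ f ∈ B, ∑' j, (‖f.2 (c j)‖₊ : ℝ≥0∞) ^ 2 ≤ ∑' i, (‖f.1 (b i)‖₊ : ℝ≥0∞) ^ 2 := by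
    intro f hf
    obtain ⟨a, ha, rfl⟩ := hmemB.1 hf
    exact hHS a ha
  have hfin' : ∀ f ∈ B, ∑' i, (‖f.1 (b i)‖₊ : ℝ≥0∞) ^ 2 < ∞ := by
    intro f hf
    obtain ⟨a, ha, rfl⟩ := hmemB.1 hf
    exact hfin a ha
  -- non-degeneracy on `W₁`
  have hnd : ∃ f ∈ B, ∃ x ∈ W₁, f.2 x ≠ 0 := by
    obtain ⟨x, hxW, hx0, hEx⟩ := hx
    have hxpos : 0 < ‖x‖ := norm_pos_iff.mpr hx0
    set U : Set 𝔊₂ := {g | ‖τ₂ (ι₂ g) x - τ₂ (ι₂ 1) x‖ < ‖x‖ / 2} with hUdef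
    have hUo : IsOpen U := isOpen_lt (((hc₂ x).sub continuous_const).norm) continuous_const
    have h1U : (1 : 𝔊₂) ∈ U := by simp [hUdef, half_pos hxpos]
    obtain ⟨a, ha, hre, hsupp, h1⟩ := h𝒜δ₂ 1 U (hUo.mem_nhds h1U)
    refine ⟨Ψ a, hmemB.2 ⟨a, ha, rfl⟩, x, hxW, fun h0 => ?_⟩
    have hest := norm_integratedOperator_apply_sub_le_of_integral_eq_one (hτ₂.restrict ι₂) hc₂ η₂
      a.2 hre h1 x 1 fun g hg => (le_of_lt (hsupp hg))
    rw [hΨ] at h0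
    change (E₂ ∘L R₂ a.2) x = 0 at h0
    rw [hER₂, ContinuousLinearMap.comp_apply, hEx] at h0
    change (τ₂.restrict ι₂).integratedOperator (hτ₂.restrict ι₂) hc₂ η₂ a.2 x = 0 at h0
    rw [h0, map_one, zero_sub, norm_neg] at hest
    change ‖x‖ ≤ ‖x‖ / 2 at hest
    linarith
  -- assemble
  exact not_isOrtho_of_typeComparison (𝔳 := PEmpty.{1}) (G := fun _ => PUnit.{1})
    (fun v => v.elim) (fun v => v.elim) (fun v => v.elim) (fun v => v.elim) B hmul hstar
    (fun v => v.elim) M hMc (fun v => v.elim) hMB b c hHS' hfin' τ₁ (Set.range ι₁)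
    (fun v => v.elim) hB₁gen hMfree' hApprox₁ τ₂ hτ₂ Kset₂ (Set.range ι₂)
    (fun γ => by
      obtain ⟨k, hk, g, rfl⟩ := hgen₂ γ
      exact ⟨k, hk, ι₂ g, ⟨g, rfl⟩, rfl⟩)
    (fun v => v.elim) E₂ hE₂idem hE₂T
    (by rintro _ ⟨g, rfl⟩ y; exact (DFunLike.congr_fun (hE₂ι g) y :))
    c₂ hE₂K hB₂T hB₂E hB₂E' hApprox₂ W₁ W₂ hW₁ hW₂ hW hnd

end TypeTestFamily

end Literature.NumberTheory.Automorphic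

/-! ### Multiplicity one for `D^×` from a type comparison datum -/

namespace Literature.NumberTheory.Automorphic

open _root_.MeasureTheory NumberField ContRepresentation

universe u

section Assembly

variable (K : Type) [Field K] [NumberField K] (D : Type u) [Ring D] [Algebra K D]
  [IsQuaternionAlgebra K D]
  {𝔊₁ : Type*} [Group 𝔊₁] [TopologicalSpace 𝔊₁] [IsTopologicalGroup 𝔊₁] [MeasurableSpace 𝔊₁]
  [BorelSpace 𝔊₁] [SecondCountableTopology 𝔊₁]
  {𝔊₂ : Type*} [Group 𝔊₂] [TopologicalSpace 𝔊₂] [IsTopologicalGroup 𝔊₂] [MeasurableSpace 𝔊₂]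
  [BorelSpace 𝔊₂] [SecondCountableTopology 𝔊₂]

/-- **Multiplicity one for `D^×` from a matched family of test functions along a type idempotent
(Gelbart's Thm. 10.10 with the operator theory of the proof of Thm. 10.5 carried out, in the form
suited to compactly supported test functions).** Fix locally compact second countable groups
`𝔊₁`, `𝔊₂` with left- and inversion-invariant measures finite on compacts and continuous
homomorphisms `ι₁ : 𝔊₁ → GL₂(𝔸_K)`, `ι₂ : 𝔊₂ → D_𝔸ˣ` (the complementary groups `G^S ≅ G'^S`,
`S ⊇ Ram(D)`), and a subset `K₂ ⊆ D_𝔸ˣ` with `D_𝔸ˣ = K₂ · ι₂(𝔊₂)` (the ramified component `G'_S`).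
Assume, for `D` division, every automorphic `μ_D` and every pair `W₁ ≅ W₂` of equivalent
irreducible closed invariant subspaces of `L²(D_𝔸ˣ ⧸ ℝ_{>0} Dˣ)` of dimension `≠ 1`: an
automorphic measure `μ` on the `GL₂` side; a self-adjoint idempotent `E₁` on `L²(GL₂)` commuting
with the commutant of the regular representation and with `R(ι₁ 𝔊₁)` (the type projection
`R(e)`, `e = (dim λ) conj ⟨λ(k) w, w⟩` on `K_S`, Jacquet–Langlands pp. 497–503); the slice
`M = {y ∈ L²_cusp : E₁ y = y}` with a Hilbert basis `(b_i)`, **multiplicity-free as a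
representation of `𝔊₁`** (closed `𝔊₁`-stable `𝔊₁`-irreducible non-zero `ρ, ρ' ≤ M` related by an
isometric `𝔊₁`-equivariant map of `ρ` onto `ρ'` coincide — strong multiplicity one for `GL₂`
and multiplicity one of the type `λ` in cuspidal local components); a Hilbert basis `(c_j)` of
`L²(D_𝔸ˣ ⧸ ℝ_{>0} Dˣ)`; a self-adjoint idempotent `E₂` on it commuting with the commutant and with
`R'(ι₂ 𝔊₂)` and acting by `E₂ R'(k) y = c₂(k) y` on `E₂`-fixed vectors for `k ∈ K₂` (the minimal
idempotent of the finite-dimensional type of `W₁` at `S`, in the tree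
`ClosedSubrep.exists_minimalIdempotent_of_compactModCenter`), with `W₁` containing a non-zero
`E₂`-fixed vector; and a `ℂ`-subspace `𝒜` of matched test-function pairs
`(F₁, F₂) ∈ C_c(𝔊₁) × C_c(𝔊₂)` closed under convolution and involution, with approximate
identities on both sides, along which **`Σ_j ‖E₂ R'(F₂) c_j‖² ≤ Σ_i ‖E₁ R(F₁) b_i‖² < ∞`** — the
trace identity (10.10) in Hilbert–Schmidt form as an inequality, i.e. the trace formulas (10.14),
(10.15) for the test functions `e' ⊗ F F^*`, `e ⊗ F F^*` and their comparison (10.16)–(10.22).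
**Then `multiplicity_one_quaternionUnits K D`.** (`not_isOrtho_of_typeTestFamily` and
`multiplicity_one_quaternionUnits_of_forall_not_isOrtho`.) Compared with
`multiplicity_one_quaternionUnits_of_testFamily`: no decomposition `GL₂(𝔸_K) = K₁ · ι₁(𝔊₁)`, no
minimality of `E₁`, and multiplicity one for `GL₂` enters only through the multiplicity-freeness
of `M`. [cite: Gelbart1975, Thm. 10.10 (proof), p. 158; Gelbart1975, Thm. 10.5 (proof),
pp. 151–155; JacquetLanglands1970, §16, Lemma 16.1.1 and pp. 496–503] -/
theorem multiplicity_one_quaternionUnits_of_typeTestFamily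
    (η₁ : Measure 𝔊₁) [IsFiniteMeasureOnCompacts η₁] [SFinite η₁] [η₁.IsMulLeftInvariant]
    [η₁.IsInvInvariant]
    (η₂ : Measure 𝔊₂) [IsFiniteMeasureOnCompacts η₂] [SFinite η₂] [η₂.IsMulLeftInvariant]
    [η₂.IsInvInvariant]
    (ι₁ : 𝔊₁ →* (AdelicGroupData.gl 2 K).Adelic) (hι₁ : Continuous ι₁)
    (ι₂ : 𝔊₂ →* (AdelicGroupData.units K D).Adelic) (hι₂ : Continuous ι₂)
    (Kset₂ : Set (AdelicGroupData.units K D).Adelic)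
    (hgen₂ : ∀ γ, ∃ k ∈ Kset₂, ∃ g : 𝔊₂, γ = k * ι₂ g)
    (h : ∀ (_hdiv : ∀ x : D, x ≠ 0 → IsUnit x)
      (μ_D : Measure (AdelicGroupData.units K D).automorphicQuotient)
      [(AdelicGroupData.units K D).IsAutomorphicMeasure μ_D]
      (W₁ W₂ : ClosedSubrep ((AdelicGroupData.units K D).rightRegular μ_D)),
      W₁.toContRep.IsTopIrreducible → W₂.toContRep.IsTopIrreducible →
      Module.finrank ℂ W₁.toSubmodule ≠ 1 → Module.finrank ℂ W₂.toSubmodule ≠ 1 →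
      AreUnitarilyEquivalent W₁.toContRep W₂.toContRep →
      ∃ (μ : Measure (AdelicGroupData.gl 2 K).automorphicQuotient)
        (_ : (AdelicGroupData.gl 2 K).IsAutomorphicMeasure μ)
        (E₁ : (AdelicGroupData.gl 2 K).L2 μ →L[ℂ] (AdelicGroupData.gl 2 K).L2 μ)
        (M : Submodule ℂ ((AdelicGroupData.gl 2 K).L2 μ))
        (ι : Type) (b : HilbertBasis ι ℂ M) (κ : Type u)
        (c : HilbertBasis κ ℂ ((AdelicGroupData.units K D).L2 μ_D))
        (E₂ : (AdelicGroupData.units K D).L2 μ_D →L[ℂ] (AdelicGroupData.units K D).L2 μ_D)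
        (c₂ : (AdelicGroupData.units K D).Adelic → ℂ)
        (𝒜 : Submodule ℂ (C_c(𝔊₁, ℂ) × C_c(𝔊₂, ℂ))),
        -- `E₁`, `M`
        (∀ u v, ⟪E₁ u, v⟫_ℂ = ⟪u, E₁ v⟫_ℂ) ∧ (∀ v, E₁ (E₁ v) = E₁ v) ∧
        (∀ U : (AdelicGroupData.gl 2 K).L2 μ →L[ℂ] (AdelicGroupData.gl 2 K).L2 μ,
          (∀ γ, U ∘L (AdelicGroupData.gl 2 K).rightRegular μ γ =
            (AdelicGroupData.gl 2 K).rightRegular μ γ ∘L U) → U ∘L E₁ = E₁ ∘L U) ∧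
        (∀ g : 𝔊₁, E₁ ∘L (AdelicGroupData.gl 2 K).rightRegular μ (ι₁ g) =
          (AdelicGroupData.gl 2 K).rightRegular μ (ι₁ g) ∘L E₁) ∧
        (∀ y, y ∈ M ↔ y ∈ cuspidalSubspace 2 K μ ∧ E₁ y = y) ∧
        -- `M` is multiplicity-free under the complementary group
        (∀ ρ ρ' : Submodule ℂ ((AdelicGroupData.gl 2 K).L2 μ),
          IsClosed (ρ : Set ((AdelicGroupData.gl 2 K).L2 μ)) →
          IsClosed (ρ' : Set ((AdelicGroupData.gl 2 K).L2 μ)) → ρ ≤ M → ρ' ≤ M →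
          ∀ (hρG : ∀ g : 𝔊₁, ∀ x ∈ ρ, (AdelicGroupData.gl 2 K).rightRegular μ (ι₁ g) x ∈ ρ)
            (_hρ'G : ∀ g : 𝔊₁, ∀ x ∈ ρ', (AdelicGroupData.gl 2 K).rightRegular μ (ι₁ g) x ∈ ρ'),
          (∀ V : Submodule ℂ ((AdelicGroupData.gl 2 K).L2 μ),
            IsClosed (V : Set ((AdelicGroupData.gl 2 K).L2 μ)) → V ≤ ρ →
            (∀ g : 𝔊₁, ∀ x ∈ V, (AdelicGroupData.gl 2 K).rightRegular μ (ι₁ g) x ∈ V) →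
            V = ⊥ ∨ V = ρ) →
          (∀ V : Submodule ℂ ((AdelicGroupData.gl 2 K).L2 μ),
            IsClosed (V : Set ((AdelicGroupData.gl 2 K).L2 μ)) → V ≤ ρ' →
            (∀ g : 𝔊₁, ∀ x ∈ V, (AdelicGroupData.gl 2 K).rightRegular μ (ι₁ g) x ∈ V) →
            V = ⊥ ∨ V = ρ') →
          ρ ≠ ⊥ →
          (∃ U : ρ →L[ℂ] ρ', (∀ x, ‖U x‖ = ‖x‖) ∧ Function.Surjective U ∧
            ∀ (g : 𝔊₁) (x : ρ), (U ⟨(AdelicGroupData.gl 2 K).rightRegular μ (ι₁ g) x,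
              hρG g x x.2⟩ : (AdelicGroupData.gl 2 K).L2 μ) =
              (AdelicGroupData.gl 2 K).rightRegular μ (ι₁ g) (U x)) →
          ρ = ρ') ∧
        -- `E₂`
        (∀ u v, ⟪E₂ u, v⟫_ℂ = ⟪u, E₂ v⟫_ℂ) ∧ (∀ v, E₂ (E₂ v) = E₂ v) ∧
        (∀ U : (AdelicGroupData.units K D).L2 μ_D →L[ℂ] (AdelicGroupData.units K D).L2 μ_D,
          (∀ γ, U ∘L (AdelicGroupData.units K D).rightRegular μ_D γ =
            (AdelicGroupData.units K D).rightRegular μ_D γ ∘L U) → U ∘L E₂ = E₂ ∘L U) ∧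
        (∀ g : 𝔊₂, E₂ ∘L (AdelicGroupData.units K D).rightRegular μ_D (ι₂ g) =
          (AdelicGroupData.units K D).rightRegular μ_D (ι₂ g) ∘L E₂) ∧
        (∀ k ∈ Kset₂, ∀ y, E₂ y = y →
          E₂ ((AdelicGroupData.units K D).rightRegular μ_D k y) = c₂ k • y) ∧
        (∃ x ∈ W₁, x ≠ 0 ∧ E₂ x = x) ∧
        -- the matched test functions
        (∀ a ∈ 𝒜, ∀ a' ∈ 𝒜, ∃ d ∈ 𝒜, (∀ x, d.1 x = mulConv η₁ (⇑a.1) (⇑a'.1) x) ∧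
          (∀ x, d.2 x = mulConv η₂ (⇑a.2) (⇑a'.2) x)) ∧
        (∀ a ∈ 𝒜, ∃ d ∈ 𝒜, (∀ x, d.1 x = mulStar (⇑a.1) x) ∧ (∀ x, d.2 x = mulStar (⇑a.2) x)) ∧
        (∀ (g : 𝔊₁) (U : Set 𝔊₁), U ∈ 𝓝 g → ∃ a ∈ 𝒜, (∀ x, 0 ≤ (a.1 x).re ∧ (a.1 x).im = 0) ∧
          tsupport a.1 ⊆ U ∧ ∫ x, (a.1 x).re ∂η₁ = 1) ∧
        (∀ (g : 𝔊₂) (U : Set 𝔊₂), U ∈ 𝓝 g → ∃ a ∈ 𝒜, (∀ x, 0 ≤ (a.2 x).re ∧ (a.2 x).im = 0) ∧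
          tsupport a.2 ⊆ U ∧ ∫ x, (a.2 x).re ∂η₂ = 1) ∧
        -- the trace inequality (10.10)
        (∀ a ∈ 𝒜,
          ∑' j, (‖E₂ ((((AdelicGroupData.units K D).rightRegular μ_D).restrict ι₂).integratedOperator
              (((AdelicGroupData.units K D).isUnitary_rightRegular μ_D).restrict ι₂)
              (((AdelicGroupData.units K D).isStronglyContinuous_rightRegular_holds μ_D).restrict
                ι₂ hι₂) η₂ a.2 (c j))‖₊ : ℝ≥0∞) ^ 2 ≤
            ∑' i, (‖E₁ ((((AdelicGroupData.gl 2 K).rightRegular μ).restrict ι₁).integratedOperator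
              (((AdelicGroupData.gl 2 K).isUnitary_rightRegular μ).restrict ι₁)
              (((AdelicGroupData.gl 2 K).isStronglyContinuous_rightRegular_holds μ).restrict
                ι₁ hι₁) η₁ a.1 (b i))‖₊ : ℝ≥0∞) ^ 2 ∧
          ∑' i, (‖E₁ ((((AdelicGroupData.gl 2 K).rightRegular μ).restrict ι₁).integratedOperator
              (((AdelicGroupData.gl 2 K).isUnitary_rightRegular μ).restrict ι₁)
              (((AdelicGroupData.gl 2 K).isStronglyContinuous_rightRegular_holds μ).restrict
                ι₁ hι₁) η₁ a.1 (b i))‖₊ : ℝ≥0∞) ^ 2 < ∞)) :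
    multiplicity_one_quaternionUnits K D := by
  refine multiplicity_one_quaternionUnits_of_forall_not_isOrtho K D
    fun hdiv μ_D _ W₁ W₂ hW₁ hW₂ h1 h1' he => ?_
  obtain ⟨μ, hμ, E₁, M, ι, b, κ, c, E₂, c₂, 𝒜, hE₁sa, hE₁idem, hE₁T, hE₁ι, hM, hMfree, hE₂sa,
    hE₂idem, hE₂T, hE₂ι, hE₂K, hx, h𝒜conv, h𝒜star, h𝒜δ₁, h𝒜δ₂, hHS⟩ :=
    h hdiv μ_D W₁ W₂ hW₁ hW₂ h1 h1' he
  haveI := hμ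
  exact not_isOrtho_of_typeTestFamily η₁ η₂ ((AdelicGroupData.gl 2 K).rightRegular μ)
    ((AdelicGroupData.gl 2 K).isUnitary_rightRegular μ) ι₁
    (((AdelicGroupData.gl 2 K).isStronglyContinuous_rightRegular_holds μ).restrict ι₁ hι₁)
    (cuspidalSubspace 2 K μ) E₁ hE₁sa hE₁idem hE₁T hE₁ι M hM hMfree b c
    ((AdelicGroupData.units K D).rightRegular μ_D)
    ((AdelicGroupData.units K D).isUnitary_rightRegular μ_D) ι₂
    (((AdelicGroupData.units K D).isStronglyContinuous_rightRegular_holds μ_D).restrict ι₂ hι₂)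
    Kset₂ hgen₂ E₂ hE₂sa hE₂idem hE₂T hE₂ι c₂ hE₂K 𝒜 h𝒜conv h𝒜star h𝒜δ₁ h𝒜δ₂
    (fun a ha => (hHS a ha).1) (fun a ha => (hHS a ha).2) W₁ W₂ hW₁ hW₂ he hx

end Assembly

end Literature.NumberTheory.Automorphic
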